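import Summits.HubbardSuperconductivity.HubbardLadder.NeelOrderParamCeiling
import Literature.MathematicalPhysics.QuantumLattice.HeisenbergMarshallSameSublattice
import Literature.MathematicalPhysics.QuantumLattice.HeisenbergRPCorrelationBlocks
import Literature.MathematicalPhysics.QuantumLattice.HeisenbergOrderNeelGD
import HarnessLib

/-!
# R2 device D19 — the Marshall–infrared floor `m_s²(L) ≥ (27 - 3√17)/(8L²)` for EVERY even `L ≥ 4`

HONEST FRAMING: ladder R1–R4 with certified numbers; no claim on H/H₀. Cell pub-hubbard, seat r2
(gen 13). Each theorem is a statement about ONE finite matrix (the spin-½ Heisenberg antiferromagnet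
`heisenbergTorus 2 L 1 J` on the `L×L` torus); none bears on H₀: the floor decays like `1/L²` and
says nothing about long-range order.

An ENERGY-FREE, SOLVER-FREE, UNIFORM-in-`L` lower bound on the R2 observable
`m_s²(L) = neelOrderParamSq L J = 3 ĝ_Q / L²` (`neelSum_eq`), improving the tree's uniform Marshall
floor `m_s²(L) ≥ 3/(2L²)` (`neelOrderParamSq_ge_three_div_two_sq`, device D8) by the factor
`(27 - 3√17)/12 = 1.2192…`:

  **`m_s²(L) ≥ (27 - 3√17)/(8L²) = 1.82883…/L²`** (`neelOrderParamSq_ge_marshall_infrared`, even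
  `L ≥ 4`, `J > 0`; decimal form `1.8288/L²`, `neelOrderParamSq_ge_decimal_div_sq`).

It is the closed-form solution of the `2×2`-FOLDED energy-free Kennedy–Lieb–Shastry linear
programme augmented by the FULL Marshall sign rule. Inputs, all in-tree theorems about the reduced
two-point function `c(a,b) = ⟨Sᶻ_0 Sᶻ_(a,b)⟩₀` (`heisRedCorr2 L 1 a b`):
(M) Marshall's sign rule `c(a,b) ≥ 0` for `a+b` even, `≤ 0` for `a+b` odd
(`heisRedCorr2_nonneg_of_even`, `heisRedCorr2_nonpos_of_odd`, Marshall 1955 / Lieb–Mattis 1962);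
(T) `c(0,0) = ¼` (`heisRedCorr2_zero_zero`); (I) the `T = 0` infrared bound
`ĝ_q² E_(q-Q) ≤ (-ε/2) E_q` (`heis_infraredBound`, Kennedy–Lieb–Shastry 1988 eqs. (12)–(19)) at the
three momenta `q = (0,0)` (giving the singlet rule `ĝ_0 = 0`), `q = (0,π)` and `q = (π,0)` (where
`E_q = E_(q-Q) = 2`, so `ĝ_q² ≤ -ε/2`), with `ε = (c(1,0)+c(0,1))/2` (`heisBondCorr_two_eq`) a FREE
variable; and the lattice symmetries `c(a,b) = c(b,a) = c(-a,-b)`.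
Writing `A, B, C, D` for the sums of `c` over the four parity classes (even,even) ∋ (0,0),
(odd,odd), (even,odd), (odd,even): `A ≥ ¼`, `C ≤ c(0,1) + c(0,L-1) = 2c(0,1)`, `D ≤ 2c(1,0)`,
`A+B+C+D = ĝ_0 = 0`, `ĝ_Q = A+B-C-D = 2(A+B)`, `ĝ_(0,π) + ĝ_(π,0) = 2(A-B)`; hence with
`X = A+B`, `t = A-B`: `X = -(C+D) ≥ 4(-ε) ≥ 8t²` and `X = 2A - t ≥ ½ - t`, so
`X ≥ min_t max(8t², ½-t) = (9-√17)/16`, `ĝ_Q ≥ (9-√17)/8`, `m_s² = 3ĝ_Q/L² ≥ (27-3√17)/(8L²)`.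
Without (M) the same programme has value `0` for `L ≥ 6`; with (M) the fold is exact for every even `L`.
Rows (R2-TABLE §A8-M, column "Marshall–IR floor", hypothesis-free): `0.0093 ≤ m_s²(14)` (first
certified row at `L = 14`), `0.0056 ≤ m_s²(18)`, `0.0045 ≤ m_s²(20)`, and `m_s²(14) ∈ [0.0093, 0.2552]`
with the operator ceiling `m_s²(L) ≤ ¼ + 1/L²` (`neelOrderParamSq_le`); for `L ≤ 12` the RP rows of
D17/D18 are stronger. QMC comparators (never inputs): `m_s²(14) ≈ 0.14` (Sandvik 1997).
References: W. Marshall, Proc. Roy. Soc. A 232 (1955) 48; E. Lieb, D. Mattis, J. Math. Phys. 3 (1962)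
749, Thm 2; T. Kennedy, E. H. Lieb, B. S. Shastry, J. Stat. Phys. 53 (1988) 1019, eqs. (12)–(19),
p. 1021; A. W. Sandvik, Phys. Rev. B 56 (1997) 11678 (comparators).
-/

noncomputable section

open Finset Literature.MathematicalPhysics.QuantumLattice Literature.Probability.LatticeModels

namespace Summit.HubbardSuperconductivity.HubbardLadder

/-! ### Trigonometric bookkeeping at the momenta `0, (0,π), (π,0), Q` of the `2k × 2k` torus -/

/-- `cos(2π · (km mod 2k) / 2k) = (-1)^m`. [folklore] -/
theorem cosNat_two_mul_half_mul (k m : ℕ) (hk : k ≠ 0) :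
    cosNat (2 * k) ((k * m) % (2 * k)) = (-1 : ℝ) ^ m := by
  rw [show (k * m) % (2 * k) = k * (m % 2) by rw [mul_comm 2 k]; exact Nat.mul_mod_mul_left k m 2]
  unfold cosNat
  have hk' : (k : ℝ) ≠ 0 := by exact_mod_cast hk
  rw [show 2 * Real.pi * ((k * (m % 2) : ℕ) : ℝ) / ((2 * k : ℕ) : ℝ) = ((m % 2 : ℕ) : ℝ) * Real.pi by
    push_cast; field_simp]
  rw [Real.cos_nat_mul_pi, ← neg_one_pow_eq_pow_mod_two]

/-- `cos(2π · (k mod 2k) / 2k) = -1`. [folklore] -/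
theorem cosNat_two_mul_half (k : ℕ) (hk : k ≠ 0) : cosNat (2 * k) (k % (2 * k)) = -1 := by
  have h := cosNat_two_mul_half_mul k 1 hk
  rwa [mul_one, pow_one] at h

/-- `cos(2π · (0 mod L) / L) = 1`. [folklore] -/
theorem cosNat_zero_mod (L : ℕ) : cosNat L (0 % L) = 1 := by
  simp [cosNat]

/-! ### The Marshall sign rule on the parity classes of the `2k × 2k` torus -/

section Marshall

variable (k : ℕ) [NeZero (2 * k)]

/-- Terms of the (even, even) class sum are nonnegative. [cite: LiebMattis1962, Theorem 2] -/
private theorem termEE_nonneg (a b : ℕ) :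
    0 ≤ (1 + (-1 : ℝ) ^ a) * (1 + (-1) ^ b) * heisRedCorr2 (2 * k) 1 a b := by
  rcases Nat.even_or_odd a with ha | ha <;> rcases Nat.even_or_odd b with hb | hb
  · rw [ha.neg_one_pow, hb.neg_one_pow]
    have := heisRedCorr2_nonneg_of_even (2 * k) (dvd_mul_right 2 k) 1 a b (ha.add hb).two_dvd
    positivity
  · rw [hb.neg_one_pow]; simp
  · rw [ha.neg_one_pow]; simp
  · rw [ha.neg_one_pow]; simp

/-- Terms of the (even, odd) class sum are nonpositive. [cite: LiebMattis1962, Theorem 2] -/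
private theorem termEO_nonpos (a b : ℕ) :
    (1 + (-1 : ℝ) ^ a) * (1 - (-1) ^ b) * heisRedCorr2 (2 * k) 1 a b ≤ 0 := by
  rcases Nat.even_or_odd a with ha | ha <;> rcases Nat.even_or_odd b with hb | hb
  · rw [hb.neg_one_pow]; simp
  · rw [ha.neg_one_pow, hb.neg_one_pow]
    have hodd : ¬ 2 ∣ a + b := fun h =>
      (Nat.not_even_iff_odd.2 (ha.add_odd hb)) (even_iff_two_dvd.2 h)
    have := heisRedCorr2_nonpos_of_odd (2 * k) (dvd_mul_right 2 k) 1 a b hodd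
    nlinarith
  · rw [ha.neg_one_pow]; simp
  · rw [ha.neg_one_pow]; simp

/-- **(M), even class**: `Σ_{a,b<2k} (1+(-1)^a)(1+(-1)^b) c(a,b) ≥ 4c(0,0) = 1` (all terms `≥ 0` by
Marshall's sign rule; the `(0,0)` term is `4 · ¼`). [cite: LiebMattis1962, Theorem 2] -/
theorem marshall_sumEE_ge_one (hk : 1 ≤ k) :
    1 ≤ ∑ a ∈ range (2 * k), ∑ b ∈ range (2 * k),
      (1 + (-1 : ℝ) ^ a) * (1 + (-1) ^ b) * heisRedCorr2 (2 * k) 1 a b := by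
  have c00 := heisRedCorr2_zero_zero (2 * k) 1
  have h0 : (0 : ℕ) ∈ range (2 * k) := mem_range.2 (by omega)
  calc (1 : ℝ) = (1 + (-1 : ℝ) ^ 0) * (1 + (-1) ^ 0) * heisRedCorr2 (2 * k) 1 0 0 := by
        rw [c00]; norm_num
    _ ≤ ∑ b ∈ range (2 * k), (1 + (-1 : ℝ) ^ 0) * (1 + (-1) ^ b) * heisRedCorr2 (2 * k) 1 0 b :=
        single_le_sum (f := fun b => (1 + (-1 : ℝ) ^ 0) * (1 + (-1) ^ b) * heisRedCorr2 (2 * k) 1 0 b)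
          (fun b _ => termEE_nonneg k 0 b) h0
    _ ≤ ∑ a ∈ range (2 * k), ∑ b ∈ range (2 * k),
          (1 + (-1 : ℝ) ^ a) * (1 + (-1) ^ b) * heisRedCorr2 (2 * k) 1 a b :=
        single_le_sum (f := fun a => ∑ b ∈ range (2 * k),
            (1 + (-1 : ℝ) ^ a) * (1 + (-1) ^ b) * heisRedCorr2 (2 * k) 1 a b)
          (fun a _ => sum_nonneg fun b _ => termEE_nonneg k a b) h0

/-- **(M), (even, odd) class**: `Σ_{a,b<2k} (1+(-1)^a)(1-(-1)^b) c(a,b) ≤ 4c(0,1) + 4c(0,2k-1) = 8c(0,1)`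
for `k ≥ 2` (all terms `≤ 0` by Marshall's sign rule; keep the two terms `(0, ±1)`, equal by
inversion symmetry). [cite: LiebMattis1962, Theorem 2] -/
theorem marshall_sumEO_le (hk : 2 ≤ k) :
    ∑ a ∈ range (2 * k), ∑ b ∈ range (2 * k),
        (1 + (-1 : ℝ) ^ a) * (1 - (-1) ^ b) * heisRedCorr2 (2 * k) 1 a b ≤
      8 * heisRedCorr2 (2 * k) 1 0 1 := by
  set f : ℕ → ℕ → ℝ := fun a b => (1 + (-1 : ℝ) ^ a) * (1 - (-1) ^ b) * heisRedCorr2 (2 * k) 1 a b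
    with hf
  have h0 : (0 : ℕ) ∈ range (2 * k) := mem_range.2 (by omega)
  have h1 : (1 : ℕ) ∈ range (2 * k) := mem_range.2 (by omega)
  have hL1 : 2 * k - 1 ∈ (range (2 * k)).erase 1 :=
    mem_erase.2 ⟨by omega, mem_range.2 (by omega)⟩
  -- inversion symmetry: `c(0, 2k-1) = c(0, 1)`
  have hinv : heisRedCorr2 (2 * k) 1 0 (2 * k - 1) = heisRedCorr2 (2 * k) 1 0 1 := by
    have h := heisRedCorr2_neg_mod (2 * k) 1 0 1
    have e0 : (2 * k - 0 % (2 * k)) % (2 * k) = 0 := by simp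
    have e1 : (2 * k - 1 % (2 * k)) % (2 * k) = 2 * k - 1 := by
      rw [Nat.mod_eq_of_lt (show 1 < 2 * k by omega), Nat.mod_eq_of_lt (show 2 * k - 1 < 2 * k by omega)]
    rw [e0, e1] at h
    exact h.symm
  have hodd : Odd (2 * k - 1) := Nat.Even.sub_odd (by omega) (even_two_mul k) odd_one
  -- outer sum: keep `a = 0`
  have houter : ∑ a ∈ range (2 * k), ∑ b ∈ range (2 * k), f a b ≤ ∑ b ∈ range (2 * k), f 0 b := by
    rw [← add_sum_erase _ _ h0]
    have : ∑ a ∈ (range (2 * k)).erase 0, ∑ b ∈ range (2 * k), f a b ≤ 0 :=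
      sum_nonpos fun a _ => sum_nonpos fun b _ => termEO_nonpos k a b
    linarith
  -- inner sum at `a = 0`: keep `b = 1` and `b = 2k - 1`
  have hinner : ∑ b ∈ range (2 * k), f 0 b ≤ f 0 1 + f 0 (2 * k - 1) := by
    rw [← add_sum_erase _ _ h1, ← add_sum_erase _ _ hL1]
    have : ∑ b ∈ ((range (2 * k)).erase 1).erase (2 * k - 1), f 0 b ≤ 0 :=
      sum_nonpos fun b _ => termEO_nonpos k 0 b
    linarith
  have hf1 : f 0 1 = 4 * heisRedCorr2 (2 * k) 1 0 1 := by
    simp only [hf]; norm_num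
  have hf2 : f 0 (2 * k - 1) = 4 * heisRedCorr2 (2 * k) 1 0 1 := by
    simp only [hf]
    rw [hodd.neg_one_pow, hinv]; norm_num
  linarith

/-- **(M), (odd, even) class**: `Σ_{a,b<2k} (1-(-1)^a)(1+(-1)^b) c(a,b) ≤ 8c(1,0)` for `k ≥ 2`
(the previous bound after `(a,b) ↦ (b,a)`). [cite: LiebMattis1962, Theorem 2] -/
theorem marshall_sumOE_le (hk : 2 ≤ k) :
    ∑ a ∈ range (2 * k), ∑ b ∈ range (2 * k),
        (1 - (-1 : ℝ) ^ a) * (1 + (-1) ^ b) * heisRedCorr2 (2 * k) 1 a b ≤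
      8 * heisRedCorr2 (2 * k) 1 1 0 := by
  have h := marshall_sumEO_le k hk
  rw [sum_comm] at h
  rw [heisRedCorr2_swap (2 * k) 1 1 0]
  refine le_trans (le_of_eq ?_) h
  refine sum_congr rfl fun a _ => sum_congr rfl fun b _ => ?_
  rw [heisRedCorr2_swap (2 * k) 1 a b]
  ring

end Marshall

/-! ### The closed-form solution of the folded programme -/

/-- `min_t max(16t², 1 - 2t) = (9 - √17)/8` (attained at `t = (√17 - 1)/16`). [folklore] -/
theorem marshall_infrared_closed_form (G t : ℝ) (h1 : 16 * t ^ 2 ≤ G) (h2 : 1 - 2 * t ≤ G) :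
    (9 - Real.sqrt 17) / 8 ≤ G := by
  have hs : Real.sqrt 17 ^ 2 = 17 := Real.sq_sqrt (by norm_num)
  have hs0 : 0 ≤ Real.sqrt 17 := Real.sqrt_nonneg _
  have hs1 : 1 ≤ Real.sqrt 17 := by nlinarith
  by_cases ht : t ≤ (Real.sqrt 17 - 1) / 16
  · linarith
  · rw [not_le] at ht
    have ht0 : 0 ≤ (Real.sqrt 17 - 1) / 16 := by linarith
    have key : (Real.sqrt 17 - 1) / 16 * ((Real.sqrt 17 - 1) / 16) ≤ t * t :=
      mul_le_mul ht.le ht.le ht0 (ht0.trans ht.le)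
    nlinarith [key, hs, h1]

/-- **The structure factor at `Q` of the `2k × 2k` torus is at least `(9 - √17)/8`** (`k ≥ 2`, spin ½):
the `2×2`-folded energy-free KLS programme with Marshall signs, solved in closed form.
[cite: KLS1988JSP, eqs. (12)–(19)] [cite: LiebMattis1962, Theorem 2] -/
theorem heisStructureFactor_neel_ge_closed_form (k : ℕ) (hk : 2 ≤ k) :
    (9 - Real.sqrt 17) / 8 ≤
      heisStructureFactor 0 (2 * k) 1 (neelIndex (2 * k) : TorusSite 2 (2 * k)) := by
  haveI : NeZero (2 * k) := ⟨by omega⟩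
  have hk0 : k ≠ 0 := by omega
  have hk2 : 2 * k / 2 = k := by omega
  have hkz : ((k : ℕ) : ZMod (2 * k)) ≠ 0 := by
    intro h
    have := Nat.le_of_dvd (by omega) ((ZMod.natCast_eq_zero_iff k (2 * k)).1 h)
    omega
  have hQ : (neelIndex (2 * k) : TorusSite 2 (2 * k)) =
      ![((k : ℕ) : ZMod (2 * k)), ((k : ℕ) : ZMod (2 * k))] := by
    ext i; fin_cases i <;> simp [neelIndex, hk2]
  have hc1 := cosNat_two_mul_half k hk0
  have hc0 := cosNat_zero_mod (2 * k)
  -- (T) `c(0,0) = 1/4` is inside `marshall_sumEE_ge_one`; the bond correlation `ε` is FREE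
  have hε2 := heisBondCorr_two_eq (2 * k) 1
  set ε := heisBondCorr (d := 2) 0 (2 * k) 1 with hεdef
  -- the four structure factors as parity-weighted sums
  set GQ := heisStructureFactor 0 (2 * k) 1 ![((k : ℕ) : ZMod (2 * k)), ((k : ℕ) : ZMod (2 * k))]
    with hGQdef
  set G1 := heisStructureFactor 0 (2 * k) 1 ![((0 : ℕ) : ZMod (2 * k)), ((k : ℕ) : ZMod (2 * k))]
    with hG1def
  set G2 := heisStructureFactor 0 (2 * k) 1 ![((k : ℕ) : ZMod (2 * k)), ((0 : ℕ) : ZMod (2 * k))]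
    with hG2def
  set Z := heisStructureFactor 0 (2 * k) 1 ![((0 : ℕ) : ZMod (2 * k)), ((0 : ℕ) : ZMod (2 * k))]
    with hZdef
  have eGQ : GQ = ∑ a ∈ range (2 * k), ∑ b ∈ range (2 * k),
      (-1 : ℝ) ^ (a + b) * heisRedCorr2 (2 * k) 1 a b := by
    rw [hGQdef, heisStructureFactor_two_eq_sum_range]
    refine sum_congr rfl fun a _ => sum_congr rfl fun b _ => ?_
    rw [← mul_add, cosNat_two_mul_half_mul k (a + b) hk0]
  have eG1 : G1 = ∑ a ∈ range (2 * k), ∑ b ∈ range (2 * k),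
      (-1 : ℝ) ^ b * heisRedCorr2 (2 * k) 1 a b := by
    rw [hG1def, heisStructureFactor_two_eq_sum_range]
    refine sum_congr rfl fun a _ => sum_congr rfl fun b _ => ?_
    rw [zero_mul, zero_add, cosNat_two_mul_half_mul k b hk0]
  have eG2 : G2 = ∑ a ∈ range (2 * k), ∑ b ∈ range (2 * k),
      (-1 : ℝ) ^ a * heisRedCorr2 (2 * k) 1 a b := by
    rw [hG2def, heisStructureFactor_two_eq_sum_range]
    refine sum_congr rfl fun a _ => sum_congr rfl fun b _ => ?_
    rw [zero_mul, add_zero, cosNat_two_mul_half_mul k a hk0]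
  have eZ : Z = ∑ a ∈ range (2 * k), ∑ b ∈ range (2 * k), heisRedCorr2 (2 * k) 1 a b := by
    rw [hZdef, heisStructureFactor_two_eq_sum_range]
    refine sum_congr rfl fun a _ => sum_congr rfl fun b _ => ?_
    rw [zero_mul, zero_mul, add_zero, hc0, one_mul]
  -- (I) at q = (0,π): `G1² ≤ -ε/2`
  obtain ⟨-, hI1⟩ := heis_infraredBound (d := 2) (by norm_num) 1 k hk
    ![((0 : ℕ) : ZMod (2 * k)), ((k : ℕ) : ZMod (2 * k))]
    (by rw [hQ]; intro h; have := congr_fun h 0; simp at this; exact hkz this.symm)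
  rw [← hG1def, dispersion_latticeMomentum_sub_neelIndex, dispersion_latticeMomentum_eq,
    torusCosSum_two_natCast, ← hεdef, hc0, hc1] at hI1
  norm_num at hI1
  -- (I) at q = (π,0): `G2² ≤ -ε/2`
  obtain ⟨-, hI2⟩ := heis_infraredBound (d := 2) (by norm_num) 1 k hk
    ![((k : ℕ) : ZMod (2 * k)), ((0 : ℕ) : ZMod (2 * k))]
    (by rw [hQ]; intro h; have := congr_fun h 1; simp at this; exact hkz this.symm)
  rw [← hG2def, dispersion_latticeMomentum_sub_neelIndex, dispersion_latticeMomentum_eq,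
    torusCosSum_two_natCast, ← hεdef, hc0, hc1] at hI2
  norm_num at hI2
  -- (I) at q = 0: `Z² · 4 ≤ 0`, i.e. the singlet rule `Z = 0`
  obtain ⟨hZ0, hI0⟩ := heis_infraredBound (d := 2) (by norm_num) 1 k hk
    ![((0 : ℕ) : ZMod (2 * k)), ((0 : ℕ) : ZMod (2 * k))]
    (by rw [hQ]; intro h; have := congr_fun h 0; simp at this; exact hkz this.symm)
  rw [← hZdef, dispersion_latticeMomentum_sub_neelIndex, dispersion_latticeMomentum_eq,
    torusCosSum_two_natCast, ← hεdef, hc0] at hI0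
  norm_num at hI0
  rw [← hZdef] at hZ0
  have hZ : Z = 0 := by nlinarith
  -- (M) the three Marshall class bounds, as linear forms in `Z, G1, G2, GQ`
  have hM1 : 1 ≤ Z + G2 + G1 + GQ := by
    have h := marshall_sumEE_ge_one k (by omega)
    rw [eZ, eG1, eG2, eGQ, ← sum_add_distrib, ← sum_add_distrib, ← sum_add_distrib]
    refine le_trans h (le_of_eq ?_)
    refine sum_congr rfl fun a _ => ?_
    rw [← sum_add_distrib, ← sum_add_distrib, ← sum_add_distrib]
    refine sum_congr rfl fun b _ => ?_
    rw [pow_add]; ring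
  have hM2 : Z + G2 - G1 - GQ ≤ 8 * heisRedCorr2 (2 * k) 1 0 1 := by
    have h := marshall_sumEO_le k hk
    rw [eZ, eG1, eG2, eGQ, ← sum_add_distrib, ← sum_sub_distrib, ← sum_sub_distrib]
    refine le_trans (le_of_eq ?_) h
    refine sum_congr rfl fun a _ => ?_
    rw [← sum_add_distrib, ← sum_sub_distrib, ← sum_sub_distrib]
    refine sum_congr rfl fun b _ => ?_
    rw [pow_add]; ring
  have hM3 : Z - G2 + G1 - GQ ≤ 8 * heisRedCorr2 (2 * k) 1 1 0 := by
    have h := marshall_sumOE_le k hk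
    rw [eZ, eG1, eG2, eGQ, ← sum_sub_distrib, ← sum_add_distrib, ← sum_sub_distrib]
    refine le_trans (le_of_eq ?_) h
    refine sum_congr rfl fun a _ => ?_
    rw [← sum_sub_distrib, ← sum_add_distrib, ← sum_sub_distrib]
    refine sum_congr rfl fun b _ => ?_
    rw [pow_add]; ring
  -- closed form with `t = (G1 + G2)/2`: `GQ ≥ -8ε ≥ 16t²` and `GQ ≥ 1 - 2t`
  rw [hQ, ← hGQdef]
  refine marshall_infrared_closed_form GQ ((G1 + G2) / 2) ?_ ?_
  · nlinarith [sq_nonneg (G1 - G2), hI1, hI2, hM2, hM3, hε2, hZ]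
  · linarith [hM1, hZ]

/-! ### The uniform floor on the Néel order parameter -/

/-- `m_s²(L)` as the staggered double sum, for every `L ≥ 1`. [folklore] -/
theorem neelOrderParamSq_eq_sum_div (L : ℕ) [NeZero L] (J : ℝ) :
    neelOrderParamSq L J =
      (∑ x : TorusSite 2 L, ∑ y : TorusSite 2 L,
          (-1 : ℝ) ^ (∑ i, (x i).val) * (-1) ^ (∑ i, (y i).val) *
            groundStateSpinCorrTorus (d := 2) L 1 J x y) / (L : ℝ) ^ 4 := by
  obtain ⟨k, rfl⟩ : ∃ k, L = k + 1 := ⟨L - 1, by have := NeZero.ne L; omega⟩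
  exact neelOrderParamSq_succ k J

/-- `m_s²(2k) = 3 ĝ_Q / (2k)²` (`J > 0`). [cite: KLS1988JSP, p. 1021] -/
theorem neelOrderParamSq_two_mul_eq (k : ℕ) [NeZero (2 * k)] {J : ℝ} (hJ : 0 < J) :
    neelOrderParamSq (2 * k) J =
      3 * (heisStructureFactor 0 (2 * k) 1 (neelIndex (2 * k) : TorusSite 2 (2 * k)) /
        ((2 * k : ℕ) : ℝ) ^ 2) := by
  have h := neelSum_eq (d := 2) 1 k hJ
  rw [show 2 * 2 = 4 from rfl] at h
  rw [neelOrderParamSq_eq_sum_div, h]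

/-- **R2 device D19, uniform row: `m_s²(L) ≥ (27 - 3√17)/(8L²)`** for every even `L ≥ 4` and
`J > 0` (energy-free, solver-free; the `2×2`-folded Marshall-augmented KLS programme in closed
form). A statement about each finite torus; decays like `1/L²`; no bearing on H₀.
HONEST FRAMING: ladder R1–R4 with certified numbers; no claim on H/H₀.
[cite: KLS1988JSP, eqs. (12)–(19)] [cite: LiebMattis1962, Theorem 2] -/
theorem neelOrderParamSq_ge_marshall_infrared (L : ℕ) [NeZero L] (hL2 : 2 ∣ L) (hL4 : 4 ≤ L)
    {J : ℝ} (hJ : 0 < J) :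
    (27 - 3 * Real.sqrt 17) / (8 * (L : ℝ) ^ 2) ≤ neelOrderParamSq L J := by
  obtain ⟨k, rfl⟩ := hL2
  have hk : 2 ≤ k := by omega
  have hG := heisStructureFactor_neel_ge_closed_form k hk
  rw [neelOrderParamSq_two_mul_eq k hJ]
  have hL : (0 : ℝ) < ((2 * k : ℕ) : ℝ) := by positivity
  rw [show (27 - 3 * Real.sqrt 17) / (8 * ((2 * k : ℕ) : ℝ) ^ 2) =
      3 * (((9 - Real.sqrt 17) / 8) / ((2 * k : ℕ) : ℝ) ^ 2) by field_simp; ring]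
  gcongr

/-- **R2 device D19, decimal form: `m_s²(L) ≥ 1.8288/L²`** for every even `L ≥ 4` and `J > 0`
(`(27 - 3√17)/8 = 1.828835…`; compare the Marshall floor `1.5/L²` of D8).
HONEST FRAMING: ladder R1–R4 with certified numbers; no claim on H/H₀.
[cite: KLS1988JSP, eqs. (12)–(19)] [cite: LiebMattis1962, Theorem 2] -/
theorem neelOrderParamSq_ge_decimal_div_sq (L : ℕ) [NeZero L] (hL2 : 2 ∣ L) (hL4 : 4 ≤ L)
    {J : ℝ} (hJ : 0 < J) :
    (1.8288 : ℝ) / (L : ℝ) ^ 2 ≤ neelOrderParamSq L J := by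
  have h := neelOrderParamSq_ge_marshall_infrared L hL2 hL4 hJ
  have hs : Real.sqrt 17 ≤ 4.1232 := by
    have := Real.sqrt_le_sqrt (show (17 : ℝ) ≤ 4.1232 ^ 2 by norm_num)
    rwa [Real.sqrt_sq (by norm_num)] at this
  have hL : (0 : ℝ) < (L : ℝ) := by exact_mod_cast (show 0 < L by omega)
  calc (1.8288 : ℝ) / (L : ℝ) ^ 2 ≤ ((27 - 3 * Real.sqrt 17) / 8) / (L : ℝ) ^ 2 :=
        div_le_div_of_nonneg_right (by linarith) (by positivity)
    _ = (27 - 3 * Real.sqrt 17) / (8 * (L : ℝ) ^ 2) := by rw [div_div]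
    _ ≤ neelOrderParamSq L J := h

/-! ### Rows (R2-TABLE §A8-M, column "Marshall–IR floor"; hypothesis-free) -/

/-- From the decimal floor: `c · L² ≤ 1.8288` gives `c ≤ m_s²(L)`. [folklore] -/
private theorem row_of_decimal {L : ℕ} [NeZero L] (hL2 : 2 ∣ L) (hL4 : 4 ≤ L) {J : ℝ}
    (hJ : 0 < J) {c : ℝ} (hc : c * (L : ℝ) ^ 2 ≤ 1.8288) : c ≤ neelOrderParamSq L J := by
  have h := neelOrderParamSq_ge_decimal_div_sq L hL2 hL4 hJ
  have hL : (0 : ℝ) < (L : ℝ) := by exact_mod_cast (show 0 < L by omega)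
  exact le_trans (by rw [le_div_iff₀ (by positivity)]; exact hc) h

/-- Row A8.14 (Marshall–IR column): `0.0093 ≤ m_s²(14)` for every `J > 0` — the first certified row at
`L = 14` (`1.8288/196 = 0.009331`; Marshall floor D8: `0.00765`; comparator QMC `≈ 0.14`).
HONEST FRAMING: ladder R1–R4 with certified numbers; no claim on H/H₀.
[cite: KLS1988JSP, eqs. (12)–(19)] [cite: LiebMattis1962, Theorem 2] -/
theorem neelOrderParamSq_fourteen_ge_marshall_infrared (J : ℝ) (hJ : 0 < J) :
    (0.0093 : ℝ) ≤ neelOrderParamSq 14 J :=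
  row_of_decimal (by norm_num) (by norm_num) hJ (by norm_num)

/-- Row A8.18 (Marshall–IR column): `0.0056 ≤ m_s²(18)` for every `J > 0` (`1.8288/324 = 0.005644`;
D8: `0.00463`); no claim on H/H₀. [cite: KLS1988JSP, eqs. (12)–(19)] [cite: LiebMattis1962, Theorem 2] -/
theorem neelOrderParamSq_eighteen_ge_marshall_infrared (J : ℝ) (hJ : 0 < J) :
    (0.0056 : ℝ) ≤ neelOrderParamSq 18 J :=
  row_of_decimal (by norm_num) (by norm_num) hJ (by norm_num)

/-- Row A8.20 (Marshall–IR column): `0.0045 ≤ m_s²(20)` for every `J > 0` (`1.8288/400 = 0.004572`;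
D8: `0.00375`); no claim on H/H₀. [cite: KLS1988JSP, eqs. (12)–(19)] [cite: LiebMattis1962, Theorem 2] -/
theorem neelOrderParamSq_twenty_ge_marshall_infrared (J : ℝ) (hJ : 0 < J) :
    (0.0045 : ℝ) ≤ neelOrderParamSq 20 J :=
  row_of_decimal (by norm_num) (by norm_num) hJ (by norm_num)

/-- Row A8.14 upper: `m_s²(14) ≤ 0.2552` (`¼ + 1/196 = 0.25510…`, operator ceiling).
[cite: Tasaki2020, §2.2, App. A.3] -/
theorem neelOrderParamSq_fourteen_le (J : ℝ) : neelOrderParamSq 14 J ≤ 0.2552 := by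
  have h := neelOrderParamSq_le 13 (by norm_num) J
  norm_num at h ⊢
  linarith

/-- Two-sided kernel bracket at `L = 14`: `m_s²(14) ∈ [0.0093, 0.2552]` for every `J > 0` (no
hypothesis; QMC comparator `≈ 0.14`). [cite: KLS1988JSP, eqs. (12)–(19)] [cite: Tasaki2020, §2.2] -/
theorem neelOrderParamSq_fourteen_mem_Icc (J : ℝ) (hJ : 0 < J) :
    neelOrderParamSq 14 J ∈ Set.Icc (0.0093 : ℝ) 0.2552 :=
  ⟨neelOrderParamSq_fourteen_ge_marshall_infrared J hJ, neelOrderParamSq_fourteen_le J⟩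

end Summit.HubbardSuperconductivity.HubbardLadder
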